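import Literature.NumberTheory.EllipticCurves.IwasawaAlgebraSpecializationCoprimeProofs
import HarnessLib

/-!
# Specialised indices at Howard's `λ`-primes `Q_m = f + p^m` and the `λ`-inequality
# `ord_f char(N) ≤ k · ord_f char(N')` from a uniform specialised index inequality (proofs file)

Topic `NumberTheory/EllipticCurves`. THEOREMS ONLY (no definition, no named fact, no `sorry`). The `λ`-TWIN of
`IwasawaAlgebraSpecializationIndexProofs` (seat x10b: the `μ`-primes `q_m = T^m + p`, `#(N ⧸ q_m N) ≍ p^{m μ(N)}`,
`μ(N) ≤ 2 μ(N')`), on the vocabulary of `IwasawaAlgebra.lean` and the sibling `IwasawaAlgebraSpecializationCoprimeProofs`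
(multiplicativity and finiteness of `#(Λ ⧸ (Q, ·))`, `#(Λ ⧸ (Q, p^μ)) = p^{μ deg Q}`). For a distinguished IRREDUCIBLE
`f ∈ ℤ_p[T]` of degree `d` — a height-one prime `(f) ≠ (p)` of `Λ = ℤ_p⟦T⟧` — Howard reads the `(f)`-part of a
divisibility of characteristic ideals off the specialisations at the primes `Q_m = (f + p^m)`, `m → ∞`
([Howard 2004], proof of Thm. 2.2.10: "fix a height-one prime `𝔓 ≠ pΛ` of `Λ` with generator `f`… `𝔔 = (f + p^m)`";
[Mazur–Rubin 2004] §5.3, proof of Thm. 5.3.10, the same device). THIS FILE is the module-theoretic half: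
`#(N ⧸ Q_m N) ≍ p^{m · d · ℓ_f(N)}` with `ℓ_f(N) = length_{Λ_(f)} N_(f)` the exponent of `(f)` in `char N`, and the
transfer «`#(N ⧸ Q_m N) ≤ p^C · #(N' ⧸ Q_m N')^k` for all large `m` ⟹ `ℓ_f(N) ≤ k · ℓ_f(N')`». Together with the
`μ`-twin this turns uniform specialised Kolyvagin-system bounds into `char(N) ∣ char(N')^k` prime by prime. Written
by the lead seat of line `birth` on crux K1 `CumulativeHeegnerInclusionAtThree` (stmt-BirchSwinnertonDyer-24198;
research child A = stmt-26896) — the integral companion of the index-currency specialisation principle. HONEST FRAMING: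
pure `Λ`-module algebra; the ARITHMETIC half (the specialised bounds themselves) is not here; BSD is not proved by any
of this.

WHAT (`Q_m` spelled `(f : Λ) + PowerSeries.C ((p : ℤ_[p]) ^ m)`; `#(N ⧸ Q_m N)` = `Nat.card (N ⧸ (Ideal.span {Q_m} • ⊤))`).
* §1 `isDistinguishedAt_add_C_pow`, `coe_add_C_pow` — `f + p^m` is distinguished of degree `deg f` (`m ≥ 1`, `deg f ≥ 1`).
* §2 ideal identities: `span_add_sup_span_pow_eq` (`(f + c, fⁿ) = (f + c, cⁿ)`, any ring elements),
  `span_add_C_pow_sup_eq_of_C_pow_mem` (`(f + p^m, h) = (f, h)` once `p^{m₀} ∈ (f, h)`, `m > m₀`),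
  `exists_C_pow_mem_of_finite` (`Λ ⧸ J` finite ⟹ some `p^k ∈ J`).
* §3 counts: `card_quotient_span_add_C_pow_sup_span_C_pow` (`#(Λ ⧸ (Q_m, p^μ)) = p^{μ d}`),
  `card_quotient_span_add_C_pow_sup_span_pow_self` (`#(Λ ⧸ (Q_m, fⁿ)) = p^{m n d}`),
  `exists_card_quotient_coe_pow_quotSMulTop_add_C_pow` (the cyclic piece `Λ/(gⁿ)`, `g` distinguished irreducible:
  `= c · p^{m d e}` for `m > m₀`, `e = n` if `f ∣ g` else `0`).
* §4 `exists_card_elementaryModule_quotSMulTop_add_C_pow` (`#(E ⧸ Q_m E) = C · p^{m d e(E)}` for large `m`),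
  `lengthAt_elementaryModule_span_coe` (`ℓ_f(E) = e(E) = Σ_{f ∣ gⱼ} nⱼ`).
* §5 **`exists_card_quotSMulTop_add_C_pow_bounds`** (`#(N ⧸ Q_m N) ≍ p^{m d ℓ_f(N)}` within `B`, `m ≥ m₁`) and
  **`lengthAt_le_mul_of_card_quotSMulTop_add_C_pow_le`** (the `λ`-TRANSFER at `(f)`).

References: [Howard2004HeegnerKolyvagin] B. Howard, *The Heegner point Kolyvagin system*, Compositio Math. 140 (2004),
proof of Thm. 2.2.10 (arXiv:1202.6340 p. 18); [MazurRubin2004] B. Mazur, K. Rubin, *Kolyvagin systems*, Mem. AMS 799,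
§5.3 (proof of Thm. 5.3.10); [Washington1997] §7.1 (Prop. 7.2), §13.2 (Lemma 13.7, Prop. 13.8, Thm. 13.12).
-/

set_option autoImplicit false

noncomputable section

open scoped Classical Pointwise Polynomial DirectSum

namespace Literature.NumberTheory.EllipticCurves

namespace IwasawaAlgebra

variable (p : ℕ) [Fact p.Prime]

/-! ### §1 Howard's `λ`-primes `Q_m = f + p^m` -/

/-- `f + p^m` is distinguished for `f` distinguished of positive degree and `m ≥ 1`.
[cite: Howard2004HeegnerKolyvagin, proof of Thm. 2.2.10 (the primes f + p^m)] [cite: Washington1997, §7.1] -/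
theorem isDistinguishedAt_add_C_pow {f : ℤ_[p][X]}
    (hf : f.IsDistinguishedAt (IsLocalRing.maximalIdeal ℤ_[p])) (hd : 0 < f.natDegree) {m : ℕ} (hm : 1 ≤ m) :
    (f + Polynomial.C ((p : ℤ_[p]) ^ m)).IsDistinguishedAt (IsLocalRing.maximalIdeal ℤ_[p]) := by
  refine ⟨⟨fun {i} hi => ?_⟩,
    hf.monic.add_of_left (Polynomial.degree_C_le.trans_lt (Polynomial.natDegree_pos_iff_degree_pos.mp hd))⟩
  rw [Polynomial.natDegree_add_C] at hi
  rw [Polynomial.coeff_add, Polynomial.coeff_C]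
  split_ifs with h0
  · refine Ideal.add_mem _ (hf.mem hi) ?_
    rw [PadicInt.maximalIdeal_eq_span_p, Ideal.mem_span_singleton]
    exact dvd_pow_self _ (by omega)
  · rw [add_zero]; exact hf.mem hi

/-- The power series of `f + p^m` is `f + C (p^m)`. [cite: Washington1997, §7.1] -/
theorem coe_add_C_pow (f : ℤ_[p][X]) (m : ℕ) :
    ((f + Polynomial.C ((p : ℤ_[p]) ^ m) : ℤ_[p][X]) : IwasawaAlgebra p) =
      (f : IwasawaAlgebra p) + PowerSeries.C ((p : ℤ_[p]) ^ m) := by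
  rw [Polynomial.coe_add, Polynomial.coe_C]

/-! ### §2 Ideal identities at `Q_m` -/

/-- `(f + c, fⁿ) = (f + c, cⁿ)` in any commutative ring: `f ≡ -c (mod f + c)`.
[cite: Howard2004HeegnerKolyvagin, proof of Thm. 2.2.10] -/
theorem span_add_sup_span_pow_eq (f c : IwasawaAlgebra p) (n : ℕ) :
    Ideal.span {f + c} ⊔ Ideal.span {f ^ n} = Ideal.span {f + c} ⊔ Ideal.span {c ^ n} := by
  have key : f + c ∣ f ^ n - (-c) ^ n := by
    have h := sub_dvd_pow_sub_pow f (-c) n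
    rwa [sub_neg_eq_add] at h
  have hneg : Ideal.span {(-c) ^ n} = Ideal.span {c ^ n} := by
    rw [neg_pow]
    exact Ideal.span_singleton_mul_left_unit ((isUnit_one.neg).pow n) _
  rw [← hneg]
  obtain ⟨k, hk⟩ := key
  apply le_antisymm
  · refine sup_le le_sup_left ((Ideal.span_singleton_le_iff_mem _).mpr ?_)
    have h1 : f ^ n = (f + c) * k + (-c) ^ n := by rw [← hk]; ring
    rw [h1]
    exact Ideal.add_mem _ (Ideal.mem_sup_left (Ideal.mul_mem_right _ _ (Ideal.mem_span_singleton_self _)))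
      (Ideal.mem_sup_right (Ideal.mem_span_singleton_self _))
  · refine sup_le le_sup_left ((Ideal.span_singleton_le_iff_mem _).mpr ?_)
    have h1 : (-c) ^ n = f ^ n - (f + c) * k := by rw [← hk]; ring
    rw [h1]
    exact Ideal.sub_mem _ (Ideal.mem_sup_right (Ideal.mem_span_singleton_self _))
      (Ideal.mem_sup_left (Ideal.mul_mem_right _ _ (Ideal.mem_span_singleton_self _)))

/-- `1 + a · p^j` is a unit of `Λ` for `j ≥ 1`. [cite: Washington1997, §7.1 (units of Λ)] -/
theorem isUnit_one_add_mul_C_pow (a : IwasawaAlgebra p) {j : ℕ} (hj : 1 ≤ j) :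
    IsUnit (1 + a * PowerSeries.C ((p : ℤ_[p]) ^ j)) := by
  rw [PowerSeries.isUnit_iff_constantCoeff, map_add, map_one, map_mul, PowerSeries.constantCoeff_C,
    show (1 : ℤ_[p]) + PowerSeries.constantCoeff a * (p : ℤ_[p]) ^ j =
      1 - (-(PowerSeries.constantCoeff a * (p : ℤ_[p]) ^ j)) by ring]
  refine IsLocalRing.isUnit_one_sub_self_of_mem_nonunits _ ?_
  rw [← IsLocalRing.mem_maximalIdeal, PadicInt.maximalIdeal_eq_span_p]
  refine Submodule.neg_mem _ (Ideal.mul_mem_left _ _ (Ideal.mem_span_singleton.mpr ?_))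
  exact dvd_pow_self _ (by omega)

/-- **`(f + p^m, h) = (f, h)`** as soon as `p^{m₀} ∈ (f, h)` and `m > m₀`
(`p^{m₀}(1 + α p^{m - m₀}) = α (f + p^m) + β h` with `1 + α p^{m-m₀} ∈ Λˣ`).
[cite: Howard2004HeegnerKolyvagin, proof of Thm. 2.2.10] [cite: Washington1997, §13.2 (Lemma 13.7)] -/
theorem span_add_C_pow_sup_eq_of_C_pow_mem {f h : IwasawaAlgebra p} {m₀ m : ℕ}
    (h0 : PowerSeries.C ((p : ℤ_[p]) ^ m₀) ∈ Ideal.span {f} ⊔ Ideal.span {h}) (hm : m₀ < m) :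
    Ideal.span {f + PowerSeries.C ((p : ℤ_[p]) ^ m)} ⊔ Ideal.span {h} = Ideal.span {f} ⊔ Ideal.span {h} := by
  have hcc : PowerSeries.C ((p : ℤ_[p]) ^ m) =
      PowerSeries.C ((p : ℤ_[p]) ^ m₀) * PowerSeries.C ((p : ℤ_[p]) ^ (m - m₀)) := by
    rw [← map_mul, ← pow_add, Nat.add_sub_cancel' hm.le]
  rw [hcc]
  set c₀ : IwasawaAlgebra p := PowerSeries.C ((p : ℤ_[p]) ^ m₀) with hc₀
  set t : IwasawaAlgebra p := PowerSeries.C ((p : ℤ_[p]) ^ (m - m₀)) with ht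
  apply le_antisymm
  · refine sup_le ((Ideal.span_singleton_le_iff_mem _).mpr ?_) le_sup_right
    refine Ideal.add_mem _ (Ideal.mem_sup_left (Ideal.mem_span_singleton_self _)) ?_
    rw [mul_comm]
    exact Ideal.mul_mem_left _ _ h0
  · refine sup_le ((Ideal.span_singleton_le_iff_mem _).mpr ?_) le_sup_right
    obtain ⟨α, y, hy, hαy⟩ := Ideal.mem_span_singleton_sup.mp h0
    -- `c₀ · v ∈ (f + c₀ t, h)` with `v = 1 + α t` a unit
    obtain ⟨v, hv'⟩ := isUnit_one_add_mul_C_pow p α (j := m - m₀) (by omega)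
    have hmem : c₀ * (1 + α * t) ∈ Ideal.span {f + c₀ * t} ⊔ Ideal.span {h} := by
      have h1 : c₀ * (1 + α * t) = α * (f + c₀ * t) + y := by
        linear_combination (-1 : IwasawaAlgebra p) * hαy
      rw [h1]
      exact Ideal.add_mem _ (Ideal.mem_sup_left (Ideal.mul_mem_left _ _ (Ideal.mem_span_singleton_self _)))
        (Ideal.mem_sup_right hy)
    have hc₀mem : c₀ ∈ Ideal.span {f + c₀ * t} ⊔ Ideal.span {h} := by
      have h2 := Ideal.mul_mem_right ((v⁻¹ : (IwasawaAlgebra p)ˣ) : IwasawaAlgebra p) _ hmem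
      rwa [← hv', mul_assoc, Units.mul_inv, mul_one] at h2
    have h4 : f + c₀ * t - c₀ * t ∈ Ideal.span {f + c₀ * t} ⊔ Ideal.span {h} :=
      Ideal.sub_mem _ (Ideal.mem_sup_left (Ideal.mem_span_singleton_self _)) (Ideal.mul_mem_right _ _ hc₀mem)
    rwa [add_sub_cancel_right] at h4

/-- A finite quotient `Λ ⧸ J` is killed by some `p^k`, i.e. `p^k ∈ J` (the order of the finite additive group,
stripped of its prime-to-`p` part, which is a unit of `ℤ_p`). [cite: Washington1997, §13.2 (Lemma 13.7)] -/
theorem exists_C_pow_mem_of_finite (J : Ideal (IwasawaAlgebra p)) [Finite (IwasawaAlgebra p ⧸ J)] :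
    ∃ k : ℕ, PowerSeries.C ((p : ℤ_[p]) ^ k) ∈ J := by
  have hp : p.Prime := Fact.out
  set n := Nat.card (IwasawaAlgebra p ⧸ J) with hn
  have hn0 : n ≠ 0 := Nat.card_pos.ne'
  have hnJ : (n : IwasawaAlgebra p) ∈ J := by
    rw [← Ideal.Quotient.eq_zero_iff_mem, map_natCast]
    have h := card_nsmul_eq_zero' (G := IwasawaAlgebra p ⧸ J) (x := 1)
    rwa [nsmul_eq_mul, mul_one] at h
  obtain ⟨e, n', hn', hne⟩ := Nat.exists_eq_pow_mul_and_not_dvd hn0 p hp.one_lt.ne'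
  have hu : IsUnit ((n' : ℤ_[p]) : ℤ_[p]) := by
    rw [PadicInt.isUnit_iff]
    exact le_antisymm (PadicInt.norm_le_one _) (not_lt.mp (mt PadicInt.norm_natCast_lt_one_iff.mp hn'))
  obtain ⟨u, hu'⟩ := hu
  refine ⟨e, ?_⟩
  have h1 : (n : IwasawaAlgebra p) = PowerSeries.C ((p : ℤ_[p]) ^ e) * PowerSeries.C (u : ℤ_[p]) := by
    rw [← map_mul, hu', ← map_natCast (PowerSeries.C (R := ℤ_[p])) n, hne]
    push_cast
    ring
  have h2 : PowerSeries.C ((p : ℤ_[p]) ^ e) =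
      (n : IwasawaAlgebra p) * PowerSeries.C ((u⁻¹ : ℤ_[p]ˣ) : ℤ_[p]) := by
    rw [h1, mul_assoc, ← map_mul, Units.mul_inv, map_one, mul_one]
  rw [h2]
  exact Ideal.mul_mem_right _ _ hnJ

/-! ### §3 Counting `Λ ⧸ (Q_m, ·)` -/

/-- `#(Λ ⧸ (Q_m, p^μ)) = p^{μ deg f}` (`Q_m = f + p^m` is distinguished of degree `deg f`).
[cite: Howard2004HeegnerKolyvagin, proof of Thm. 2.2.10] [cite: Washington1997, §13.2 (Prop. 13.8)] -/
theorem card_quotient_span_add_C_pow_sup_span_C_pow {f : ℤ_[p][X]}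
    (hf : f.IsDistinguishedAt (IsLocalRing.maximalIdeal ℤ_[p])) (hd : 0 < f.natDegree)
    {m : ℕ} (hm : 1 ≤ m) (μ : ℕ) :
    Nat.card (IwasawaAlgebra p ⧸ (Ideal.span {(f : IwasawaAlgebra p) + PowerSeries.C ((p : ℤ_[p]) ^ m)} ⊔
      Ideal.span {PowerSeries.C ((p : ℤ_[p]) ^ μ)})) = p ^ (μ * f.natDegree) := by
  rw [← coe_add_C_pow, card_quotient_span_coe_sup_span_C_pow p (isDistinguishedAt_add_C_pow p hf hd hm) μ,
    Polynomial.natDegree_add_C]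

/-- **`#(Λ ⧸ (Q_m, fⁿ)) = p^{m n deg f}`**: modulo `Q_m = f + p^m` one has `fⁿ ≡ (-p^m)ⁿ`.
[cite: Howard2004HeegnerKolyvagin, proof of Thm. 2.2.10] [cite: Washington1997, §13.2 (Lemma 13.7, Prop. 13.8)] -/
theorem card_quotient_span_add_C_pow_sup_span_pow_self {f : ℤ_[p][X]}
    (hf : f.IsDistinguishedAt (IsLocalRing.maximalIdeal ℤ_[p])) (hd : 0 < f.natDegree)
    {m : ℕ} (hm : 1 ≤ m) (n : ℕ) :
    Nat.card (IwasawaAlgebra p ⧸ (Ideal.span {(f : IwasawaAlgebra p) + PowerSeries.C ((p : ℤ_[p]) ^ m)} ⊔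
      Ideal.span {(f : IwasawaAlgebra p) ^ n})) = p ^ (m * n * f.natDegree) := by
  rw [span_add_sup_span_pow_eq, ← map_pow, ← pow_mul,
    card_quotient_span_add_C_pow_sup_span_C_pow p hf hd hm]

/-- A distinguished irreducible polynomial is a prime element of `Λ`. [cite: Washington1997, §13.2] -/
theorem prime_coe_of_irreducible {f : ℤ_[p][X]}
    (hf : f.IsDistinguishedAt (IsLocalRing.maximalIdeal ℤ_[p])) (hirr : Irreducible f) :
    Prime (f : IwasawaAlgebra p) :=
  (Ideal.span_singleton_prime (coe_ne_zero_of_monic p hf.monic)).mp (isPrime_span_coe p hf hirr)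

/-- A distinguished irreducible polynomial has positive degree. [cite: Washington1997, §7.1] -/
theorem natDegree_pos_of_irreducible {f : ℤ_[p][X]}
    (hf : f.IsDistinguishedAt (IsLocalRing.maximalIdeal ℤ_[p])) (hirr : Irreducible f) : 0 < f.natDegree :=
  hf.monic.natDegree_pos.mpr fun h1 => hirr.not_isUnit (h1 ▸ isUnit_one)

/-- **The cyclic piece `Λ/(gⁿ)` modulo `Q_m`**, `g` distinguished irreducible: there are `c ≥ 1`, `m₀` with
`#((Λ/(gⁿ)) ⧸ Q_m) = c · p^{m · deg f · e}` for all `m > m₀`, where `e = n` if `f ∣ g` (then `(gⁿ) = (fⁿ)`, `c = 1`)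
and `e = 0` otherwise (then `(Q_m, gⁿ) = (f, gⁿ)` is eventually constant and finite).
[cite: Howard2004HeegnerKolyvagin, proof of Thm. 2.2.10] [cite: Washington1997, §13.2 (Lemma 13.7, Thm. 13.12)] -/
theorem exists_card_quotient_coe_pow_quotSMulTop_add_C_pow {f : ℤ_[p][X]}
    (hf : f.IsDistinguishedAt (IsLocalRing.maximalIdeal ℤ_[p])) (hirr : Irreducible f)
    {g : ℤ_[p][X]} (hg : g.IsDistinguishedAt (IsLocalRing.maximalIdeal ℤ_[p])) (hgirr : Irreducible g) (n : ℕ) :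
    ∃ c m₀ : ℕ, 0 < c ∧ ∀ m : ℕ, m₀ < m →
      Nat.card ((IwasawaAlgebra p ⧸ Ideal.span {(g : IwasawaAlgebra p) ^ n}) ⧸
        (Ideal.span {(f : IwasawaAlgebra p) + PowerSeries.C ((p : ℤ_[p]) ^ m)} • ⊤ :
          Submodule (IwasawaAlgebra p) (IwasawaAlgebra p ⧸ Ideal.span {(g : IwasawaAlgebra p) ^ n}))) =
      c * p ^ (m * (f.natDegree * (if (f : IwasawaAlgebra p) ∣ (g : IwasawaAlgebra p) then n else 0))) := by
  have hp : p.Prime := Fact.out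
  have hd := natDegree_pos_of_irreducible p hf hirr
  have hfprime := prime_coe_of_irreducible p hf hirr
  by_cases hdvd : (f : IwasawaAlgebra p) ∣ (g : IwasawaAlgebra p)
  · -- `(gⁿ) = (fⁿ)`
    have hassoc : Associated (f : IwasawaAlgebra p) (g : IwasawaAlgebra p) :=
      hfprime.irreducible.associated_of_dvd (prime_coe_of_irreducible p hg hgirr).irreducible hdvd
    have hspan : Ideal.span {(g : IwasawaAlgebra p) ^ n} = Ideal.span {(f : IwasawaAlgebra p) ^ n} :=
      Ideal.span_singleton_eq_span_singleton.mpr (hassoc.symm.pow_pow)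
    refine ⟨1, 0, Nat.one_pos, fun m hm => ?_⟩
    rw [if_pos hdvd, card_quotient_quotSMulTop, hspan, sup_comm,
      card_quotient_span_add_C_pow_sup_span_pow_self p hf hd (by omega) n, one_mul]
    ring_nf
  · -- `gⁿ` is prime to `f`: `(Q_m, gⁿ) = (f, gⁿ)` eventually, a finite quotient
    have hrel : IsRelPrime ((g : IwasawaAlgebra p) ^ n) (f : IwasawaAlgebra p) :=
      IsRelPrime.pow_left (hfprime.irreducible.isRelPrime_iff_not_dvd.mpr hdvd).symm
    haveI hfin : Finite (IwasawaAlgebra p ⧸ (Ideal.span {(f : IwasawaAlgebra p)} ⊔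
        Ideal.span {(g : IwasawaAlgebra p) ^ n})) := finite_quotient_span_coe_sup_span p hf hrel
    obtain ⟨m₀, hm₀⟩ := exists_C_pow_mem_of_finite p
      (Ideal.span {(f : IwasawaAlgebra p)} ⊔ Ideal.span {(g : IwasawaAlgebra p) ^ n})
    refine ⟨Nat.card (IwasawaAlgebra p ⧸ (Ideal.span {(f : IwasawaAlgebra p)} ⊔
        Ideal.span {(g : IwasawaAlgebra p) ^ n})), m₀, Nat.card_pos, fun m hm => ?_⟩
    rw [if_neg hdvd, mul_zero, mul_zero, pow_zero, mul_one, card_quotient_quotSMulTop, sup_comm,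
      span_add_C_pow_sup_eq_of_C_pow_mem p hm₀ hm]

/-! ### §4 The elementary module at `Q_m` and its length at `(f)` -/

/-- **`#(E(μs, fs) ⧸ Q_m) = C · p^{m · deg f · e(E)}` for all large `m`**, with
`e(E) = Σ_{f ∣ gⱼ} nⱼ` the multiplicity of `(f)` in `char E` (`fⱼ = gⱼ` distinguished irreducible) and `C ≥ 1`
independent of `m` (the `p`-primary pieces contribute the constant `p^{deg f · Σ μᵢ}`).
[cite: Howard2004HeegnerKolyvagin, proof of Thm. 2.2.10] [cite: Washington1997, §13.2 (Thm. 13.12)] -/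
theorem exists_card_elementaryModule_quotSMulTop_add_C_pow {f : ℤ_[p][X]}
    (hf : f.IsDistinguishedAt (IsLocalRing.maximalIdeal ℤ_[p])) (hirr : Irreducible f)
    {μs : List ℕ} {fs : List (ℤ_[p][X] × ℕ)}
    (hfs : ∀ g ∈ fs, g.1.IsDistinguishedAt (IsLocalRing.maximalIdeal ℤ_[p]) ∧ Irreducible g.1) :
    ∃ C m₁ : ℕ, 0 < C ∧ ∀ m : ℕ, m₁ ≤ m →
      Nat.card ((elementaryModule p μs fs) ⧸
        (Ideal.span {(f : IwasawaAlgebra p) + PowerSeries.C ((p : ℤ_[p]) ^ m)} • ⊤ :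
          Submodule (IwasawaAlgebra p) (elementaryModule p μs fs))) =
      C * p ^ (m * (f.natDegree *
        (fs.map fun g => if (f : IwasawaAlgebra p) ∣ (g.1 : IwasawaAlgebra p) then g.2 else 0).sum)) := by
  have hp : p.Prime := Fact.out
  have hd := natDegree_pos_of_irreducible p hf hirr
  -- per-piece constants and thresholds
  have hpiece := fun j : Fin fs.length =>
    exists_card_quotient_coe_pow_quotSMulTop_add_C_pow p hf hirr (hfs _ (List.get_mem fs j)).1
      (hfs _ (List.get_mem fs j)).2 (fs.get j).2
  choose c m₀ hc hcm using hpiece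
  refine ⟨p ^ (μs.sum * f.natDegree) * ∏ j, c j, (∑ j, m₀ j) + 1,
    Nat.mul_pos (pow_pos hp.pos _) (Finset.prod_pos fun j _ => hc j), fun m hm => ?_⟩
  have hm1 : 1 ≤ m := by omega
  have hmj : ∀ j, m₀ j < m := fun j =>
    lt_of_le_of_lt (Finset.single_le_sum (f := m₀) (fun _ _ => Nat.zero_le _) (Finset.mem_univ j)) (by omega)
  set q : IwasawaAlgebra p := (f : IwasawaAlgebra p) + PowerSeries.C ((p : ℤ_[p]) ^ m) with hqdef
  have e : elementaryModule p μs fs ≃ₗ[IwasawaAlgebra p]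
      ((⨁ i : Fin μs.length,
          IwasawaAlgebra p ⧸ Ideal.span {PowerSeries.C ((p : ℤ_[p]) ^ μs.get i)}) ×
        ⨁ j : Fin fs.length,
          IwasawaAlgebra p ⧸ Ideal.span {((fs.get j).1 : IwasawaAlgebra p) ^ (fs.get j).2}) :=
    LinearEquiv.refl _ _
  rw [Module.card_quotSMulTop_eq_of_linearEquiv
      (M' := ((⨁ i : Fin μs.length,
          IwasawaAlgebra p ⧸ Ideal.span {PowerSeries.C ((p : ℤ_[p]) ^ μs.get i)}) ×
        ⨁ j : Fin fs.length,
          IwasawaAlgebra p ⧸ Ideal.span {((fs.get j).1 : IwasawaAlgebra p) ^ (fs.get j).2})) _ e,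
    Module.card_prod_quotSMulTop
      (⨁ i : Fin μs.length, IwasawaAlgebra p ⧸ Ideal.span {PowerSeries.C ((p : ℤ_[p]) ^ μs.get i)})
      (⨁ j : Fin fs.length, IwasawaAlgebra p ⧸ Ideal.span {((fs.get j).1 : IwasawaAlgebra p) ^ (fs.get j).2})
      (Ideal.span {q}),
    Module.card_directSum_quotSMulTop, Module.card_directSum_quotSMulTop]
  -- `p`-primary pieces: the constant `p^{deg f · Σ μᵢ}`
  rw [Finset.prod_congr rfl fun i _ => by
      rw [card_quotient_quotSMulTop, sup_comm, hqdef, card_quotient_span_add_C_pow_sup_span_C_pow p hf hd hm1],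
    Finset.prod_pow_eq_pow_sum]
  -- distinguished pieces
  rw [Finset.prod_congr rfl fun j _ => hcm j m (hmj j), Finset.prod_mul_distrib, Finset.prod_pow_eq_pow_sum,
    ← Finset.mul_sum, ← Finset.mul_sum]
  have hsum1 : ∑ i : Fin μs.length, μs.get i * f.natDegree = μs.sum * f.natDegree := by
    rw [← Finset.sum_mul]; simp [Fin.sum_univ_getElem]
  have hsum2 : ∑ j : Fin fs.length,
      (if (f : IwasawaAlgebra p) ∣ ((fs.get j).1 : IwasawaAlgebra p) then (fs.get j).2 else 0) =
      (fs.map fun g => if (f : IwasawaAlgebra p) ∣ (g.1 : IwasawaAlgebra p) then g.2 else 0).sum := by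
    simp_rw [List.get_eq_getElem]
    exact Fin.sum_univ_fun_getElem fs
      (fun g : ℤ_[p][X] × ℕ => if (f : IwasawaAlgebra p) ∣ (g.1 : IwasawaAlgebra p) then g.2 else 0)
  rw [hsum1, hsum2]
  ring

/-- **`ℓ_f(E(μs, fs)) = Σ_{f ∣ gⱼ} nⱼ`**: the local length of the elementary module at the height-one prime `(f)`
(`f` distinguished irreducible) — the `p`-primary pieces contribute `0` (`p ∉ (f)`), the piece `Λ/(gⱼ^{nⱼ})` contributes
`nⱼ` if `f ∣ gⱼ` and `0` otherwise. [cite: Washington1997, §13.2 (Thm. 13.12: the exponents of char)] -/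
theorem lengthAt_elementaryModule_span_coe {f : ℤ_[p][X]}
    (hf : f.IsDistinguishedAt (IsLocalRing.maximalIdeal ℤ_[p])) (hirr : Irreducible f)
    {μs : List ℕ} {fs : List (ℤ_[p][X] × ℕ)}
    (hfs : ∀ g ∈ fs, g.1.IsDistinguishedAt (IsLocalRing.maximalIdeal ℤ_[p]) ∧ Irreducible g.1)
    (𝔭 : PrimeSpectrum (IwasawaAlgebra p)) (h𝔭 : 𝔭.asIdeal = Ideal.span {(f : IwasawaAlgebra p)}) :
    Module.lengthAt (IwasawaAlgebra p) (elementaryModule p μs fs) 𝔭 =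
      ((fs.map fun g => if (f : IwasawaAlgebra p) ∣ (g.1 : IwasawaAlgebra p) then g.2 else 0).sum : ℕ) := by
  have hfprime := prime_coe_of_irreducible p hf hirr
  have h1 : 𝔭.asIdeal.height = 1 := by
    rw [h𝔭]; exact Module.height_span_singleton_eq_one_of_prime hfprime
  -- `p ∉ (f)`
  have hpf : PowerSeries.C (p : ℤ_[p]) ∉ 𝔭.asIdeal := by
    intro hmem
    rw [h𝔭, Ideal.mem_span_singleton] at hmem
    haveI := isPrime_span_coe p hf hirr
    haveI : (Ideal.span {PowerSeries.C (p : ℤ_[p])} : Ideal (IwasawaAlgebra p)).IsPrime :=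
      (Ideal.span_singleton_prime (prime_C p).ne_zero).mpr (prime_C p)
    have hle : Ideal.span {PowerSeries.C (p : ℤ_[p])} ≤ Ideal.span {(f : IwasawaAlgebra p)} :=
      (Ideal.span_singleton_le_iff_mem _).mpr (Ideal.mem_span_singleton.mpr hmem)
    have heq := Module.eq_of_height_le_one_of_le (h𝔭 ▸ h1).le
      (by rw [Ne, Ideal.span_singleton_eq_bot]; exact (prime_C p).ne_zero) hle
    have hf' : (f : IwasawaAlgebra p) ∈ Ideal.span {PowerSeries.C (p : ℤ_[p])} :=
      heq ▸ Ideal.mem_span_singleton_self _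
    exact not_C_dvd_coe_of_monic p hf.monic (Ideal.mem_span_singleton.mp hf')
  have e : elementaryModule p μs fs ≃ₗ[IwasawaAlgebra p]
      ((⨁ i : Fin μs.length,
          IwasawaAlgebra p ⧸ Ideal.span {PowerSeries.C ((p : ℤ_[p]) ^ μs.get i)}) ×
        ⨁ j : Fin fs.length,
          IwasawaAlgebra p ⧸ Ideal.span {((fs.get j).1 : IwasawaAlgebra p) ^ (fs.get j).2}) :=
    LinearEquiv.refl _ _
  rw [Module.lengthAt_eq_of_linearEquiv
      (N := ((⨁ i : Fin μs.length,
          IwasawaAlgebra p ⧸ Ideal.span {PowerSeries.C ((p : ℤ_[p]) ^ μs.get i)}) ×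
        ⨁ j : Fin fs.length,
          IwasawaAlgebra p ⧸ Ideal.span {((fs.get j).1 : IwasawaAlgebra p) ^ (fs.get j).2})) e,
    Module.lengthAt_prod, Module.lengthAt_directSum, Module.lengthAt_directSum]
  rw [Finset.sum_congr rfl fun i _ => by rw [lengthAt_quotient_C_pow _ 𝔭 h1, if_neg hpf, smul_zero],
    Finset.sum_const_zero, zero_add]
  rw [Finset.sum_congr rfl fun j _ => by
      rw [Module.lengthAt_quotient_span_singleton_pow
          (coe_ne_zero_of_monic p (hfs _ (List.get_mem fs j)).1.monic),
        Module.lengthAt_quotient_span_singleton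
          (prime_coe_of_irreducible p (hfs _ (List.get_mem fs j)).1 (hfs _ (List.get_mem fs j)).2) 𝔭 h1,
        h𝔭, Ideal.mem_span_singleton]]
  rw [show ∑ j : Fin fs.length, ((fs.get j).2 • (if (f : IwasawaAlgebra p) ∣ ((fs.get j).1 : IwasawaAlgebra p)
        then 1 else 0 : ℕ∞)) =
      ∑ j : Fin fs.length, ((if (f : IwasawaAlgebra p) ∣ ((fs.get j).1 : IwasawaAlgebra p)
        then (fs.get j).2 else 0 : ℕ) : ℕ∞) from Finset.sum_congr rfl fun j _ => by
      split_ifs <;> simp,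
    ← Nat.cast_sum]
  congr 1
  simp_rw [List.get_eq_getElem]
  exact Fin.sum_univ_fun_getElem fs
    (fun g : ℤ_[p][X] × ℕ => if (f : IwasawaAlgebra p) ∣ (g.1 : IwasawaAlgebra p) then g.2 else 0)

end IwasawaAlgebra

end Literature.NumberTheory.EllipticCurves

end
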